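import Literature.NumberTheory.Automorphic.BrandtXi
import HarnessLib

/-!
# The first Brandt matrix is the identity: `T(1) = 1`

Topic `NumberTheory/Automorphic`; theorems only, about the tree's definition `Brandt.matrix O n`
(`Literature/NumberTheory/Automorphic/BrandtXi.lean`, Voight (41.1.1):
`T(n)_ij = #{J ⊆ I_j : [I_j : J] = n², [J] = [I_i]}`). For `n = 1` the only sub-lattice of index
`1` of `I_j` is `I_j` itself, and `I_j = α I_i` for a unit `α` exactly when the classes agree, so
`T(1)` is the identity matrix (Voight §41.1; Pizer 1980 §2, `B(1) = I`; Gross 1987 §1). This is the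
first sanity property of the vendored Brandt matrices (it holds for every `ℤ`-lattice `O` in any
ring `D`, no arithmetic input being needed):

* `Brandt.ClassSet.eq_of_rep_eq_smul` : `I_j = α I_i ⇒ i = j`;
* `Brandt.matrix_one_apply`, `Brandt.matrix_one` : `T(1) = 1`.

## References

* J. Voight, *Quaternion Algebras*, GTM 288 (2021), §41.1, (41.1.1) [Voight2021].
* A. Pizer, J. Algebra 64 (1980), §2 [Pizer1980].
-/

noncomputable section

open scoped Pointwise

universe u

namespace Literature.NumberTheory.Automorphic

namespace Brandt

variable {D : Type u} [Ring D]

/-- If the chosen representatives of two classes differ by a unit, `I_j = α I_i`, the classes are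
equal (definition of `Cls O`, Voight Def. 17.3.1). [folklore] -/
theorem ClassSet.eq_of_rep_eq_smul {O : Submodule ℤ D} {i j : ClassSet O} {α : Dˣ}
    (h : j.rep = α • i.rep) : i = j := by
  rw [← ClassSet.mk_rep i, ← ClassSet.mk_rep j]
  exact Quotient.sound ⟨α, h⟩

/-- A sub-lattice of index `1` is everything: `J ≤ I` and `[I : J] = 1` force `J = I`. [folklore] -/
theorem eq_of_le_of_relIndex_eq_one {I J : Submodule ℤ D} (hle : J ≤ I)
    (hidx : J.toAddSubgroup.relIndex I.toAddSubgroup = 1) : J = I := by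
  refine le_antisymm hle ?_
  have h : I.toAddSubgroup ≤ J.toAddSubgroup := AddSubgroup.relIndex_eq_one.mp hidx
  exact fun x hx => h hx

/-- The set counted by `T(1)_ij` is `{I_j}` if `i = j` and empty otherwise. [folklore] -/
theorem brandtSet_one_eq (O : Submodule ℤ D) [DecidableEq (ClassSet O)] (i j : ClassSet O) :
    {J : Submodule ℤ D | J ≤ j.rep ∧ J.toAddSubgroup.relIndex j.rep.toAddSubgroup = 1 ^ 2 ∧
        ∃ α : Dˣ, J = α • i.rep} = if i = j then {j.rep} else ∅ := by
  ext J
  simp only [one_pow, Set.mem_setOf_eq]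
  constructor
  · rintro ⟨hle, hidx, α, hα⟩
    have hJ : J = j.rep := eq_of_le_of_relIndex_eq_one hle hidx
    have hij : i = j := ClassSet.eq_of_rep_eq_smul (hJ ▸ hα)
    rw [if_pos hij, Set.mem_singleton_iff]
    exact hJ
  · intro hJ
    by_cases hij : i = j
    · rw [if_pos hij, Set.mem_singleton_iff] at hJ
      subst hJ
      subst hij
      exact ⟨le_rfl, AddSubgroup.relIndex_self _, 1, (one_smul _ _).symm⟩
    · rw [if_neg hij] at hJ
      exact hJ.elim

/-- **`T(1)_ij = δ_ij`** (Voight §41.1; Pizer 1980 §2). [cite: Voight2021, (41.1.1)] -/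
theorem matrix_one_apply (O : Submodule ℤ D) [DecidableEq (ClassSet O)] (i j : ClassSet O) :
    matrix O 1 i j = if i = j then 1 else 0 := by
  rw [matrix, Matrix.of_apply, brandtSet_one_eq]
  split_ifs with hij
  · rw [Set.ncard_singleton, Nat.cast_one]
  · rw [Set.ncard_empty, Nat.cast_zero]

/-- **The first Brandt matrix is the identity**, `T(1) = 1` (Voight §41.1; Pizer 1980 §2,
`B(1) = I`). [cite: Voight2021, (41.1.1)] -/
theorem matrix_one (O : Submodule ℤ D) [DecidableEq (ClassSet O)] : matrix O 1 = 1 := by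
  ext i j
  rw [matrix_one_apply, Matrix.one_apply]

end Brandt

end Literature.NumberTheory.Automorphic

end
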